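import Summits.BirchSwinnertonDyer.BirchSwinnertonDyer.Theorems.PrintCf2SplitBadTwoCMShaLocalDescentTower
import Literature.NumberTheory.EllipticCurves.ShaRestrictionJZeroLocalDescent
import HarnessLib

/-!
# Crux `PrintCf2.SplitBadTwoRankOneOfFacts` (item stmt-BirchSwinnertonDyer-20368), road α over the CM field:
# EXACT LOCAL DESCENT OF `Ш` along `K₀ = ℚ(√−7) ⊇ ℚ` for `j = −3375`: `res x ∈ Ш(E_{K₀}/K₀) ⇒ x ∈ Ш(E/ℚ)`

Cell `bsd-print-cf2`, width seat `bsd-line-cf2-p1-w8` g2 (brick **B6e-i**, part 3: the global assembly of the Ш local descent of memo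
`Cruxes/SplitBadTwoRankOneOfFacts/SHA-CM-DESCENT-w8g0.md` §«What is missing»); `--supports stmt-BirchSwinnertonDyer-20368` (helper).
HONEST FRAMING: nothing here closes a crux or a stub; BSD is not proved by any of this; no summit statement is proved by this seat.
No definition is introduced. beyond-print theorem: no.

* §1 (ANY number fields `K ⊆ L = K + K ω`, `ω² = −n < 0`): `exists_eq_add_mul_adicCompletion'`, `exists_eq_add_mul_completion_of_sq_eq_neg`
  — `L_w = K_v + K_v ω` at every place (the JZero file's private lemmas, re-proved for `ω² = −n`), and the generic assembly
  **`mem_sha_of_resBaseChange_mem_sha_of_towerDescent`**: IF every tower `K → E → E' = E + E·ω` descends exactly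
  (`localRestrictionKer W E' ≤ localRestrictionKer W E`), THEN `res x ∈ Ш(E_L/L) ⇒ x ∈ Ш(E/K)` — the proof of the tree's
  `JZero.mem_sha_of_resBaseChange_mem_sha` with the local descent abstracted into a hypothesis.
* §2 (the CM class): **`mem_sha_of_resBaseChange_mem_sha_cm7`** — `W/ℚ` elliptic with `j = −3375`, `K` a quadratic number field with
  `θ² = −7`: `res x ∈ Ш(W_K/K) ⇒ x ∈ Ш(W/ℚ)`, by §1 and this seat's `mem_localRestrictionKer_of_tower_cm7` (file
  `…CMShaLocalDescentTower`); `mem_sha_iff_resBaseChange_mem_sha_cm7`, `sha_eq_comap_resBaseChange_cm7` (`Ш(W/ℚ) = res⁻¹ Ш(W_K/K)`),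
  `mem_sha_of_resBaseChange_mem_sha_cm7_of_isImaginaryQuadratic`. With -w8 g0's `shaRestriction_injective_of_cm` (B6c) and
  `existsUnique_resBaseChange_eq_of_conjH1Points_eq_cm` (B6d) this identifies `Ш(W/ℚ)` with the conjugation-fixed part of
  `Ш(W_{K₀}/K₀)` (next file).

References: J.-P. Serre, *Galois Cohomology*, I.§2.4, I.§5.8 [SerreGaloisCohomology1997]; T. and V. Dokchitser, Ann. of Math. 172
(2010), Lemma 4.14 (proof: the `|G|²`-bound this sharpens for the CM class) [DokchitserDokchitserAnnals2010]; B. H. Gross, LMS LNS 153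
(1991) §5 (5.1). [GrossLMS1991]
-/

noncomputable section

open scoped Classical

set_option linter.dupNamespace false
set_option autoImplicit false

namespace Summit.BirchSwinnertonDyer.BirchSwinnertonDyer.Theorems.PrintCf2.CMPrimes

open WeierstrassCurve Literature.NumberTheory.EllipticCurves Field NumberField IsDedekindDomain
open Literature.NumberTheory.QuadraticFields

/-! ## §1 Generic assembly over the places of a number field -/

section Generic

variable {K : Type} [Field K] [NumberField K] (W : WeierstrassCurve K)
variable (L : Type) [Field L] [NumberField L] [Algebra K L]

/-- **`L_w = K_v + K_v ω` at a finite place `w ∣ v`** when `L = K + K ω`: the `K_v`-span of `1, ω` in `L_w` is finite-dimensional,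
hence closed, and contains the dense image of `L` (the tree's private `ShaRestrictionJZeroLocalDescent.exists_eq_add_mul_adicCompletion`,
re-proved). [folklore] -/
theorem exists_eq_add_mul_adicCompletion' {ω : L} (hL : ∀ x : L, ∃ a b : K, x = algebraMap K L a + algebraMap K L b * ω)
    (v : HeightOneSpectrum (𝓞 K)) (w : HeightOneSpectrum (𝓞 L)) [w.asIdeal.LiesOver v.asIdeal] (y : w.adicCompletion L) :
    ∃ a b : v.adicCompletion K, y = adicCompletionMap (K := K) L v w a +
      adicCompletionMap (K := K) L v w b * algebraMap L (w.adicCompletion L) ω := by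
  have hcont : Continuous (adicCompletionMap (K := K) L v w) := by
    unfold adicCompletionMap
    exact (HeightOneSpectrum.adicCompletion.continuous_ofCompletion L w).comp
      ((UniformSpace.Completion.continuous_map).comp (HeightOneSpectrum.adicCompletion.continuous_toCompletion K v))
  have hcoe : ∀ x : K, adicCompletionMap (K := K) L v w (algebraMap K (v.adicCompletion K) x) =
      algebraMap L (w.adicCompletion L) (algebraMap K L x) := fun x ↦ adicCompletionMap_coe (K := K) L v w x
  letI : Algebra (v.adicCompletion K) (w.adicCompletion L) := (adicCompletionMap (K := K) L v w).toAlgebra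
  haveI : ContinuousSMul (v.adicCompletion K) (w.adicCompletion L) := ⟨(hcont.comp continuous_fst).mul continuous_snd⟩
  let S : Submodule (v.adicCompletion K) (w.adicCompletion L) :=
    Submodule.span (v.adicCompletion K) {1, algebraMap L (w.adicCompletion L) ω}
  haveI : FiniteDimensional (v.adicCompletion K) S := FiniteDimensional.span_of_finite _ ((Set.finite_singleton _).insert _)
  have hSclosed : IsClosed (S : Set (w.adicCompletion L)) := by
    open scoped Valued in exact S.closed_of_finiteDimensional
  have h1 : (1 : w.adicCompletion L) ∈ S := Submodule.subset_span (Set.mem_insert _ _)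
  have hω : algebraMap L (w.adicCompletion L) ω ∈ S := Submodule.subset_span (Set.mem_insert_of_mem _ (Set.mem_singleton _))
  have hKS : ∀ a : K, algebraMap L (w.adicCompletion L) (algebraMap K L a) =
      algebraMap K (v.adicCompletion K) a • (1 : w.adicCompletion L) := fun a ↦ by
    rw [Algebra.smul_def, mul_one, RingHom.algebraMap_toAlgebra, hcoe]
  have hLS : Set.range (algebraMap L (w.adicCompletion L)) ⊆ S := by
    rintro _ ⟨l, rfl⟩
    obtain ⟨a, b, rfl⟩ := hL l
    rw [map_add, map_mul, hKS a, hKS b, smul_mul_assoc, one_mul]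
    exact S.add_mem (S.smul_mem _ h1) (S.smul_mem _ hω)
  have hSuniv : (S : Set (w.adicCompletion L)) = Set.univ := by
    apply Set.eq_univ_of_univ_subset
    rw [← (HeightOneSpectrum.denseRange_algebraMap L w).closure_range]
    exact closure_minimal hLS hSclosed
  have hy : y ∈ S := by
    rw [← SetLike.mem_coe, hSuniv]
    exact Set.mem_univ y
  obtain ⟨a, b, hab⟩ := Submodule.mem_span_pair.mp hy
  refine ⟨a, b, ?_⟩
  rw [← hab, Algebra.smul_def, Algebra.smul_def, mul_one, RingHom.algebraMap_toAlgebra]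

omit [NumberField K] [NumberField L] in
/-- **`L_w = K_v + K_v ω` at an infinite place `w ∣ v`** for `ω² = −n`, `n > 0`: either `w` is unramified over `K` and `L_w = K_v`,
or `w` is ramified, `v` is real and `K_v ≅ ℝ` contains no square root of `−n`, so `1, ω` is a `K_v`-basis of the quadratic
`L_w/K_v` (Mathlib `finrank_eq_two_of_isRamified`). [folklore] -/
theorem exists_eq_add_mul_completion_of_sq_eq_neg {ω : L} {n : ℕ} (hn : 0 < n) (hω : ω ^ 2 = -(n : L))
    (v : InfinitePlace K) (w : InfinitePlace L) [w.1.LiesOver v.1] :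
    letI : Algebra v.Completion w.Completion := NumberField.LiesOver.instAlgebraCompletion
    ∀ y : w.Completion, ∃ a b : v.Completion,
      y = algebraMap v.Completion w.Completion a + algebraMap v.Completion w.Completion b * algebraMap L w.Completion ω := by
  letI : Algebra v.Completion w.Completion := NumberField.LiesOver.instAlgebraCompletion
  obtain ⟨hfin, -⟩ := finrank_completion_le_two (K := K) L v w
  haveI : FiniteDimensional v.Completion w.Completion := hfin
  intro y
  by_cases hun : w.IsUnramified K
  · have h1 := InfinitePlace.Completion.finrank_eq_one_of_isUnramified v hun
    have hy : y ∈ (⊤ : Subalgebra v.Completion w.Completion) := Algebra.mem_top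
    rw [← Subalgebra.bot_eq_top_of_finrank_eq_one h1, Algebra.mem_bot] at hy
    obtain ⟨a, rfl⟩ := hy
    exact ⟨a, 0, by rw [map_zero, zero_mul, add_zero]⟩
  · have h2 := InfinitePlace.Completion.finrank_eq_two_of_isRamified v hun
    have hv : v.IsReal := InfinitePlace.IsRamified.liesOver_isReal_under (w := w) (v := v) hun
    have hnot : algebraMap L w.Completion ω ∉ Set.range (algebraMap v.Completion w.Completion) := by
      rintro ⟨r, hr⟩
      have hr2 : r ^ 2 = -(n : v.Completion) := by
        apply (algebraMap v.Completion w.Completion).injective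
        rw [map_pow, hr, ← map_pow, hω, map_neg, map_natCast, map_neg, map_natCast]
      have hs : (InfinitePlace.Completion.ringEquivRealOfIsReal hv r) ^ 2 = -(n : ℝ) := by
        rw [← map_pow, hr2, map_neg, map_natCast]
      have hn' : (0 : ℝ) < n := by exact_mod_cast hn
      nlinarith [sq_nonneg (InfinitePlace.Completion.ringEquivRealOfIsReal hv r)]
    exact Quadratic.exists_eq_add_mul h2 hnot y

/-- **EXACT LOCAL DESCENT OF `Ш` ALONG `L = K(ω) ⊇ K` FROM A TOWER ORACLE.** `E = W/K` elliptic over a number field `K`, `L = K + K ω`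
a number field with `ω² = −n`, `n > 0`. Suppose every tower of fields `K → E → E' = E + E·ω` (`E'/E` finite, `char E = 0`, `E'` an
`L`-algebra compatibly) descends exactly: `localRestrictionKer W E' ≤ localRestrictionKer W E`. If `res x ∈ H¹(L, E_L)` of a class
`x ∈ H¹(K, E)` lies in `Ш(E_L/L)`, then `x ∈ Ш(E/K)`: at a place `v` of `K` pick `w ∣ v`; `res x` dies in `H¹(L_w, E_L)`, i.e. `x`
dies in `H¹(L_w, E)` (`mem_localRestrictionKer_iff_resBaseChange_mem`), hence in `H¹(K_v, E)` by the oracle along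
`L_w = K_v + K_v ω` (`exists_eq_add_mul_adicCompletion'`, `exists_eq_add_mul_completion_of_sq_eq_neg`). The proof of the tree's
`JZero.mem_sha_of_resBaseChange_mem_sha` with its CM step abstracted. Serre, *Galois Cohomology*, I.§2.4, I.§5.8; Dokchitser–Dokchitser
2010, Lemma 4.14 (proof). [cite: SerreGaloisCohomology1997, I.§2.4 (Prop. 9 and Cor.) and I.§5.8] -/
theorem mem_sha_of_resBaseChange_mem_sha_of_towerDescent {ω : L} {n : ℕ} (hn : 0 < n) (hω : ω ^ 2 = -(n : L))
    (hL : ∀ x : L, ∃ a b : K, x = algebraMap K L a + algebraMap K L b * ω)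
    (hdesc : ∀ (E E' : Type) [Field E] [Field E'] [Algebra K E] [Algebra K E'] [Algebra E E'] [IsScalarTower K E E']
      [FiniteDimensional E E'] [Algebra L E'] [IsScalarTower K L E'] [CharZero E],
      (∀ y : E', ∃ a b : E, y = algebraMap E E' a + algebraMap E E' b * algebraMap L E' ω) →
      W.localRestrictionKer E' ≤ W.localRestrictionKer E)
    {x : W.galH1} (hx : resBaseChange W L x ∈ (W.baseChange L).sha) : x ∈ W.sha := by
  rw [WeierstrassCurve.mem_sha_iff] at hx ⊢
  refine ⟨fun v ↦ ?_, fun v ↦ ?_⟩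
  · -- finite places
    obtain ⟨w, hw⟩ := exists_liesOver L v
    haveI := hw
    obtain ⟨hfin, -⟩ := finrank_adicCompletion_le_of_liesOver L v w
    letI : Algebra (v.adicCompletion K) (w.adicCompletion L) := (adicCompletionMap (K := K) L v w).toAlgebra
    haveI : IsScalarTower K (v.adicCompletion K) (w.adicCompletion L) :=
      IsScalarTower.of_algebraMap_eq fun x ↦ (adicCompletionMap_coe (K := K) L v w x).symm
    haveI : FiniteDimensional (v.adicCompletion K) (w.adicCompletion L) := hfin
    haveI : CharZero (v.adicCompletion K) := charZero_of_injective_algebraMap (algebraMap K (v.adicCompletion K)).injective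
    have hx' : x ∈ W.localRestrictionKer (w.adicCompletion L) := (mem_localRestrictionKer_iff_resBaseChange_mem W x).mpr (hx.1 w)
    refine hdesc (v.adicCompletion K) (w.adicCompletion L) (fun y ↦ ?_) hx'
    obtain ⟨a, b, h⟩ := exists_eq_add_mul_adicCompletion' L hL v w y
    exact ⟨a, b, h⟩
  · -- infinite places
    obtain ⟨w, hw⟩ := InfinitePlace.comap_surjective (k := K) (K := L) v
    subst hw
    set v : InfinitePlace K := w.comap (algebraMap K L)
    haveI : w.1.LiesOver v.1 := ⟨rfl⟩
    obtain ⟨hfin, -⟩ := finrank_completion_le_two (K := K) L v w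
    haveI : IsScalarTower K L w.Completion := IsScalarTower.of_algebraMap_eq fun x ↦ by
      apply NumberField.InfinitePlace.Completion.ext
      rw [NumberField.InfinitePlace.Completion.algebraMap_toCompletion, NumberField.InfinitePlace.Completion.algebraMap_toCompletion,
        UniformSpace.Completion.algebraMap_def, UniformSpace.Completion.algebraMap_def, IsScalarTower.algebraMap_apply K L (WithAbs w.1)]
    letI : Algebra v.Completion w.Completion := NumberField.LiesOver.instAlgebraCompletion
    haveI : IsScalarTower K v.Completion w.Completion := NumberField.LiesOver.instIsScalarTowerCompletion
    haveI : FiniteDimensional v.Completion w.Completion := hfin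
    haveI : CharZero v.Completion := charZero_of_injective_algebraMap (algebraMap K v.Completion).injective
    have hx' : x ∈ W.localRestrictionKer w.Completion := (mem_localRestrictionKer_iff_resBaseChange_mem W x).mpr (hx.2 w)
    exact hdesc v.Completion w.Completion (exists_eq_add_mul_completion_of_sq_eq_neg L hn hω v w) hx'

end Generic

/-! ## §2 The CM class: `j = −3375`, `K₀ = ℚ(√−7)` -/

section CM

variable (W : WeierstrassCurve ℚ) [W.IsElliptic]

/-- **EXACT LOCAL DESCENT of `Ш` along `K₀ = ℚ(√−7) ⊇ ℚ` for the CM class `j = −3375`.** `W/ℚ` elliptic with `j = −3375`, `K` a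
quadratic number field with `θ² = −7` (so `K = ℚ + ℚ θ`, `Quadratic.exists_eq_add_mul`, as `θ ∉ ℚ`). If the restriction
`res x ∈ H¹(K, W_K)` of `x ∈ H¹(ℚ, W)` lies in `Ш(W_K/K)` then `x ∈ Ш(W/ℚ)`: the oracle of `mem_sha_of_resBaseChange_mem_sha_of_towerDescent`
is this seat's `mem_localRestrictionKer_of_tower_cm7` (every tower `ℚ_v → K_w = ℚ_v + ℚ_v θ`, and `ℝ → ℂ`, descends exactly — the
trace-one witness `Q = −πP`). This sharpens the tree's `two_nsmul_mem_sha_of_resBaseChange_mem_sha` (`2x ∈ Ш`, any quadratic `K`)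
for the class: Dokchitser–Dokchitser's local terms `H¹(Gal(K_w/ℚ_v), E(K_w))` VANISH. With -w8 g0's `shaRestriction_injective_of_cm`:
`Ш(W/ℚ) ≅ res(H¹(ℚ, W)) ∩ Ш(W_K/K)`. Serre, *Galois Cohomology*, I.§2.4, I.§5.8; Gross 1991 §5 (5.1) (shape).
[cite: SerreGaloisCohomology1997, I.§2.4 (Prop. 9 and Cor.) and I.§5.8] [cite: SilvermanATAEC1994, II §2 Thm. 2.2(b) and App. A §3 (row D = -7)] -/
theorem mem_sha_of_resBaseChange_mem_sha_cm7 (hj : W.j = -3375) (K : Type) [Field K] [NumberField K] {θ : K} (hθ : θ ^ 2 = -7)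
    (h2 : Module.finrank ℚ K = 2) {x : W.galH1} (hx : resBaseChange W K x ∈ (W.baseChange K).sha) : x ∈ W.sha := by
  have hnot : θ ∉ Set.range (algebraMap ℚ K) := by
    rintro ⟨q, hq⟩
    have hq2 : q ^ 2 = -7 := by
      apply (algebraMap ℚ K).injective
      rw [map_pow, hq, hθ, map_neg, map_ofNat]
    nlinarith [sq_nonneg q]
  have hθ' : θ ^ 2 = -((7 : ℕ) : K) := by rw [hθ]; norm_num
  exact mem_sha_of_resBaseChange_mem_sha_of_towerDescent W K (by norm_num) hθ' (Quadratic.exists_eq_add_mul h2 hnot)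
    (fun E E' _ _ _ _ _ _ _ _ _ _ hE' _ hc ↦ mem_localRestrictionKer_of_tower_cm7 W hj K hθ hE' hc) hx

/-- **`x ∈ Ш(W/ℚ) ⇔ res x ∈ Ш(W_K/K)`** for `j = −3375` and `K ∋ √−7` quadratic (the tree's `resBaseChange_mem_sha` and
`mem_sha_of_resBaseChange_mem_sha_cm7`). [cite: SerreGaloisCohomology1997, I.§2.4 (Prop. 9 and Cor.) and I.§5.8] -/
theorem mem_sha_iff_resBaseChange_mem_sha_cm7 (hj : W.j = -3375) (K : Type) [Field K] [NumberField K] {θ : K} (hθ : θ ^ 2 = -7)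
    (h2 : Module.finrank ℚ K = 2) (x : W.galH1) : x ∈ W.sha ↔ resBaseChange W K x ∈ (W.baseChange K).sha :=
  ⟨resBaseChange_mem_sha W K, fun hx ↦ mem_sha_of_resBaseChange_mem_sha_cm7 W hj K hθ h2 hx⟩

/-- **`Ш(W/ℚ) = res⁻¹ Ш(W_K/K)`** as subgroups of `H¹(ℚ, W)`, for `j = −3375` and `K ∋ √−7` quadratic.
[cite: SerreGaloisCohomology1997, I.§2.4 (Prop. 9 and Cor.) and I.§5.8] -/
theorem sha_eq_comap_resBaseChange_cm7 (hj : W.j = -3375) (K : Type) [Field K] [NumberField K] {θ : K} (hθ : θ ^ 2 = -7)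
    (h2 : Module.finrank ℚ K = 2) : W.sha = ((W.baseChange K).sha).comap (resBaseChange W K) := by
  ext x
  rw [AddSubgroup.mem_comap]
  exact mem_sha_iff_resBaseChange_mem_sha_cm7 W hj K hθ h2 x

/-- The crux's setting BY NAME: `K` imaginary quadratic (`IsImaginaryQuadratic K`: `[K : ℚ] = 2`) with `θ² = −7` (`K = K₀ = ℚ(√−7)`):
`res x ∈ Ш(W_K/K) ⇒ x ∈ Ш(W/ℚ)` for every `W/ℚ` elliptic with `j = −3375`. [cite: SerreGaloisCohomology1997, I.§2.4 (Prop. 9 and Cor.) and I.§5.8] -/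
theorem mem_sha_of_resBaseChange_mem_sha_cm7_of_isImaginaryQuadratic (hj : W.j = -3375) (K : Type) [Field K] [NumberField K]
    (hK : IsImaginaryQuadratic K) {θ : K} (hθ : θ ^ 2 = -7) {x : W.galH1}
    (hx : resBaseChange W K x ∈ (W.baseChange K).sha) : x ∈ W.sha :=
  mem_sha_of_resBaseChange_mem_sha_cm7 W hj K hθ hK.1 hx

end CM

end Summit.BirchSwinnertonDyer.BirchSwinnertonDyer.Theorems.PrintCf2.CMPrimes

end
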